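import Summits.Parity.GeneralizedHardyLittlewood.Theorems.LiouvilleShiftedTablesSieveToMAvgCore

/-!
# Sieve glue for `SieveToMAvg`, part 12h: the theorem

Closing file for item stmt-Parity-14274 (route `LiouvilleShiftedTables`):

  `SieveToMAvg_proof : DilatedTableChowla → TypeI2Dilated → BVLiouville → MAvg`.

Given `h ≥ 1`: `c = −h`; `ρ` from `TypeI2Dilated`; `δ = min(ρ/4, 1/12)`; the two cruxes at the
exponents `C = 4·16421`, `A = 2·20536` give `HypII`, `HypI2` for large heights, whence the core bound
`CoreSum h Q Y ≤ Y/(log Y)^6` for `Q ≤ Y^{δ/4}` (part 12g).  With `ε = δ/8`, `K₀ = ⌊(log x)^4⌋` and the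
reduction of part 11b (`MAvgSum_le`), `MAvgSum h ε x ≤ 10ε · x/log x` for large `x`, which is `o(x)`.
`BVLiouville` is not used.
-/

namespace Summit.Parity.GeneralizedHardyLittlewood.Theorems.SieveToMAvg

open Finset Real Filter Asymptotics
open scoped ArithmeticFunction.Moebius ArithmeticFunction.vonMangoldt ArithmeticFunction.Omega
  ArithmeticFunction.zeta ArithmeticFunction.omega
open Literature.NumberTheory.Sieve.BVMoebius (eventually_log_rpow_le_rpow')
open Summit.Parity.GeneralizedHardyLittlewood.Theses.LiouvilleShiftedTables

/-- `CoreSum ≥ 0`. [folklore] -/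
theorem CoreSum_nonneg (h Q : ℕ) (X : ℝ) : 0 ≤ CoreSum h Q X :=
  Finset.sum_nonneg fun _ _ => abs_nonneg _

/-- `MAvgSum ≥ 0`. [folklore] -/
theorem MAvgSum_nonneg (h : ℕ) (ε x : ℝ) : 0 ≤ MAvgSum h ε x := by
  unfold MAvgSum
  refine Finset.sum_nonneg fun m hm => mul_nonneg (Real.log_nonneg ?_) (abs_nonneg _)
  exact_mod_cast (Finset.mem_Icc.1 hm).1

/-- **From the core bound to `MAvgSum = O(x / log x)`.** If `CoreSum h Q Y ≤ Y/(log Y)^6` for all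
large `Y` and all `Q ≤ Y^{δ/4}` (`0 < δ ≤ 1/12`), then with `ε = δ/8`, for all large `x`,
`MAvgSum h ε x ≤ x / log x`. [folklore] -/
theorem MAvgSum_le_eventually {h : ℕ} (hh : 1 ≤ h) {δ : ℝ} (hδ : 0 < δ) (hδ12 : δ ≤ 1 / 12)
    (hcore : ∀ᶠ Y : ℝ in atTop, ∀ Q : ℕ, (Q : ℝ) ≤ Y ^ (δ / 4) → CoreSum h Q Y ≤ Y / Real.log Y ^ 6) :
    ∀ᶠ x : ℝ in atTop, MAvgSum h (δ / 8) x ≤ x / Real.log x := by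
  obtain ⟨Y₀, hY₀⟩ := Filter.eventually_atTop.1 hcore
  have hlog : Tendsto (fun x : ℝ => Real.log x) atTop atTop := Real.tendsto_log_atTop
  have hh1 : (1 : ℝ) ≤ h := by exact_mod_cast hh
  filter_upwards [Filter.eventually_ge_atTop Y₀, Filter.eventually_ge_atTop (h : ℝ), Filter.eventually_ge_atTop (2 : ℝ),
    hlog.eventually_ge_atTop 2, eventually_log_rpow_le_rpow' ((8 : ℕ) : ℝ) (by positivity : (0 : ℝ) < δ / 8)]
    with x hxY₀ hxh hx2 hL2 hL8
  set ε : ℝ := δ / 8 with hεdef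
  have hε0 : 0 < ε := by positivity
  have hε1 : ε ≤ 1 / 96 := by rw [hεdef]; linarith
  have hx1 : 1 ≤ x := by linarith
  have hx0 : 0 < x := by linarith
  set L := Real.log x with hLdef
  have hL1 : 1 ≤ L := by linarith
  have hL0 : 0 < L := by linarith
  -- `K₀ = ⌊L^4⌋`
  set K₀ : ℕ := ⌊L ^ 4⌋₊ with hK₀def
  have hL4 : 2 ≤ L ^ 4 := le_trans (by norm_num) (pow_le_pow_left₀ (by norm_num : (0 : ℝ) ≤ 2) hL2 4)
  have hK₀1 : 1 ≤ K₀ := Nat.le_floor (by simp; linarith)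
  have hK₀le : (K₀ : ℝ) ≤ L ^ 4 := Nat.floor_le (by positivity)
  have hK₀ge : L ^ 4 / 2 ≤ K₀ := by
    have := Nat.lt_floor_add_one (L ^ 4); rw [← hK₀def] at this; linarith
  have hK₀pos : (0 : ℝ) < K₀ := by exact_mod_cast hK₀1
  -- the level `Q₀ = K₀² ⌊x^ε⌋ ≤ (x+h)^{δ/4}`
  have hY : x ≤ x + h := by linarith
  have hY1 : 1 ≤ x + h := by linarith
  have hQ₀ : ((K₀ ^ 2 * ⌊x ^ ε⌋₊ : ℕ) : ℝ) ≤ (x + h) ^ (δ / 4) := by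
    push_cast
    have h1 : (⌊x ^ ε⌋₊ : ℝ) ≤ x ^ ε := Nat.floor_le (Real.rpow_nonneg hx0.le ε)
    have h2 : (K₀ : ℝ) ^ 2 ≤ L ^ 8 := by nlinarith
    have hL8' : L ^ 8 ≤ x ^ (δ / 8) := by
      have e : L ^ 8 = L ^ (((8 : ℕ) : ℝ)) := (Real.rpow_natCast _ _).symm
      rw [e]; exact hL8
    calc (K₀ : ℝ) ^ 2 * ⌊x ^ ε⌋₊ ≤ L ^ 8 * x ^ ε := mul_le_mul h2 h1 (Nat.cast_nonneg _) (by positivity)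
      _ ≤ x ^ (δ / 8) * x ^ ε := mul_le_mul_of_nonneg_right hL8' (Real.rpow_nonneg hx0.le ε)
      _ = x ^ (δ / 4) := by rw [← Real.rpow_add hx0, hεdef]; ring_nf
      _ ≤ (x + h) ^ (δ / 4) := Real.rpow_le_rpow hx0.le hY (by positivity)
  have hcoreY := hY₀ (x + h) (by linarith) (K₀ ^ 2 * ⌊x ^ ε⌋₊) hQ₀
  have hred := MAvgSum_le hh hK₀1 hε0.le hx1 (ε := ε)
  -- logarithms of `x + h`
  have hlogY : L ≤ Real.log (x + h) := Real.log_le_log hx0 hY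
  have hlogY2 : Real.log (x + h) ≤ 2 * L := by
    have h1 : Real.log (x + h) ≤ Real.log (2 * x) := Real.log_le_log (by linarith) (by linarith)
    rw [Real.log_mul (by norm_num) hx0.ne'] at h1
    have : Real.log 2 < 1 := by have := Real.log_two_lt_d9; linarith
    linarith
  have hlogY1 : 1 ≤ Real.log (x + h) := hL1.trans hlogY
  -- Term 1
  have hT1 : ε * L * K₀ * CoreSum h (K₀ ^ 2 * ⌊x ^ ε⌋₊) (x + h) ≤ 2 * ε * (x / L) := by
    have hC : CoreSum h (K₀ ^ 2 * ⌊x ^ ε⌋₊) (x + h) ≤ 2 * x / L ^ 6 := by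
      refine hcoreY.trans ?_
      calc (x + h) / Real.log (x + h) ^ 6 ≤ (2 * x) / Real.log (x + h) ^ 6 :=
            div_le_div_of_nonneg_right (by linarith) (by positivity)
        _ ≤ 2 * x / L ^ 6 := div_le_div_of_nonneg_left (by linarith) (by positivity) (pow_le_pow_left₀ hL0.le hlogY 6)
    calc ε * L * K₀ * CoreSum h (K₀ ^ 2 * ⌊x ^ ε⌋₊) (x + h) ≤ ε * L * L ^ 4 * (2 * x / L ^ 6) := by
          refine mul_le_mul (mul_le_mul_of_nonneg_left hK₀le (by positivity)) hC (CoreSum_nonneg _ _ _) (by positivity)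
      _ = 2 * ε * (x / L) := by field_simp
  -- Term 2
  have hT2 : ε * L * (x * Real.log (x + h)) * Hsum (x ^ ε) / K₀ ≤ 8 * ε * (x / L) := by
    have hH : Hsum (x ^ ε) ≤ 2 * L := by
      have h1 := Hsum_le_log (Real.one_le_rpow hx1 hε0.le)
      rw [Real.log_rpow hx0] at h1
      have : ε * L ≤ L := by nlinarith
      linarith
    rw [div_le_iff₀ hK₀pos]
    calc ε * L * (x * Real.log (x + h)) * Hsum (x ^ ε) ≤ ε * L * (x * (2 * L)) * (2 * L) := by
          have := Hsum_nonneg (x ^ ε)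
          gcongr
      _ = 8 * ε * (x / L) * (L ^ 4 / 2) := by field_simp; ring
      _ ≤ 8 * ε * (x / L) * K₀ := mul_le_mul_of_nonneg_left hK₀ge (by positivity)
  -- conclusion
  have hfin : 2 * ε * (x / L) + 8 * ε * (x / L) ≤ x / L := by
    have : 0 ≤ x / L := by positivity
    nlinarith
  have hred' : MAvgSum h ε x ≤ ε * L * K₀ * CoreSum h (K₀ ^ 2 * ⌊x ^ ε⌋₊) (x + h) +
      ε * L * (x * Real.log (x + h)) * Hsum (x ^ ε) / K₀ := hred
  linarith

/-- **The core bound from the two cruxes.** [folklore] -/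
theorem core_of_cruxes (hD : DilatedTableChowla) (hI : TypeI2Dilated) {h : ℕ} (hh : 1 ≤ h) :
    ∃ δ : ℝ, 0 < δ ∧ δ ≤ 1 / 12 ∧
      ∀ᶠ Y : ℝ in atTop, ∀ Q : ℕ, (Q : ℝ) ≤ Y ^ (δ / 4) → CoreSum h Q Y ≤ Y / Real.log Y ^ 6 := by
  have hc : (-(h : ℤ)) ≠ 0 := by omega
  obtain ⟨ρ, hρ, hfam⟩ := hI (-(h : ℤ)) hc
  set δ : ℝ := min (ρ / 4) (1 / 12) with hδdef
  have hδ : 0 < δ := lt_min (by positivity) (by norm_num)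
  have hδ12 : δ ≤ 1 / 12 := min_le_right _ _
  have hδρ : 4 * δ ≤ ρ := by have := min_le_left (ρ / 4) (1 / 12); rw [← hδdef] at this; linarith
  -- Type I₂
  have hApos : (0 : ℝ) < ((2 * 20536 : ℕ) : ℝ) := by norm_num
  obtain ⟨C₂, x₀I, hI2⟩ := hfam _ hApos
  have hI2ev : ∀ᶠ Y : ℝ in atTop, HypI2 Y (-(h : ℤ)) h ρ (((2 * 20536 : ℕ) : ℝ)) (max C₂ 0) := by
    filter_upwards [Filter.eventually_ge_atTop x₀I, Filter.eventually_ge_atTop (1 : ℝ)] with Y hY hY1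
    intro R S y hR hRx hS hSR hy hyx
    refine (hI2 Y hY h R S y hR hRx hS hSR hy hyx).trans ?_
    have : 0 ≤ Y / Real.log Y ^ (((2 * 20536 : ℕ) : ℝ)) :=
      div_nonneg (by linarith) (Real.rpow_nonneg (Real.log_nonneg hY1) _)
    calc C₂ * Y / Real.log Y ^ (((2 * 20536 : ℕ) : ℝ)) = C₂ * (Y / Real.log Y ^ (((2 * 20536 : ℕ) : ℝ))) := by ring
      _ ≤ max C₂ 0 * (Y / Real.log Y ^ (((2 * 20536 : ℕ) : ℝ))) := mul_le_mul_of_nonneg_right (le_max_left _ _) this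
      _ = max C₂ 0 * Y / Real.log Y ^ (((2 * 20536 : ℕ) : ℝ)) := by ring
  -- Type II
  have hCpos : (0 : ℝ) < ((4 * 16421 : ℕ) : ℝ) := by norm_num
  obtain ⟨x₀II, hII⟩ := hD (-(h : ℤ)) hc δ hδ hδ12 _ hCpos
  have hIIev : ∀ᶠ Y : ℝ in atTop, HypII Y (-(h : ℤ)) δ (((4 * 16421 : ℕ) : ℝ)) := by
    filter_upwards [Filter.eventually_ge_atTop x₀II] with Y hY
    exact fun A hA1 hA2 u v => hII Y hY A hA1 hA2 u v
  exact ⟨δ, hδ, hδ12, core_eventually hh hδ hδ12 hδρ (le_max_right C₂ 0) hIIev hI2ev⟩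

/-- **`SieveToMAvg`** (item stmt-Parity-14274): the dilated Chowla tables and the `(r,s)`-bilinear
Type-I₂ bound for `λ` imply `MAvg` — for every `h ≥ 1` some `ε > 0` with
`∑_{m ≤ x^ε} log m |∑_{d ≤ x/m} μ(d) Λ(dm+h)| = o(x)`.  (`BVLiouville` is not needed.) [folklore] -/
theorem SieveToMAvg_proof : SieveToMAvg := by
  intro hD hI _hB h hh
  obtain ⟨δ, hδ, hδ12, hcore⟩ := core_of_cruxes hD hI hh
  refine ⟨δ / 8, by positivity, ?_⟩
  show (fun x : ℝ => MAvgSum h (δ / 8) x) =o[atTop] fun x : ℝ => x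
  have hev := MAvgSum_le_eventually hh hδ hδ12 hcore
  refine Asymptotics.isLittleO_iff.2 fun c hc => ?_
  have hlog : Tendsto (fun x : ℝ => Real.log x) atTop atTop := Real.tendsto_log_atTop
  filter_upwards [hev, hlog.eventually_ge_atTop c⁻¹, Filter.eventually_gt_atTop (0 : ℝ)] with x hx hL hx0
  have hL0 : 0 < Real.log x := lt_of_lt_of_le (inv_pos.2 hc) hL
  rw [Real.norm_eq_abs, Real.norm_eq_abs, abs_of_nonneg (MAvgSum_nonneg h _ x), abs_of_pos hx0]
  refine hx.trans ?_
  rw [div_le_iff₀ hL0]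
  calc x = c * x * c⁻¹ := by field_simp
    _ ≤ c * x * Real.log x := mul_le_mul_of_nonneg_left hL (by positivity)

end Summit.Parity.GeneralizedHardyLittlewood.Theorems.SieveToMAvg
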